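import Mathlib
import HarnessLib
import Literature.Probability.LatticeModels.TorusFourierMomentBound
import Summits.HubbardSuperconductivity.HubbardSuperconductivity.Theorems.KLProgrammeKLRegimeEngineTwoLegPlainLineLowerBound

/-!
# Route `KLProgramme` — engine support (E1 docket item (2), two-leg member; the (ℛ1) dictionary of `E2-CELL-READER.md` §6): on the PRODUCT torus
# `(ℤ/P)¹ × (ℤ/L)²` the single-direction DIFFERENCES of a SYMBOL are bounded by the corresponding POSITION MOMENTS of its character sum

Cell `gate-hubbard-kl`, seat hubbard-kl-k3c2-p3 (g19).  The (E2)-CELL-READER (`…EngineTwoLegCellReaderData/EffAction/EffActionMixed`) reads the input-family two-leg cell from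
ORDER-THREE single-direction differences of the two-leg SYMBOL `g` (through p3's Leibniz lemma `norm_fwdDiff_iter_three_smul_mul_le_of_support`: data `b_k ≥ ‖Δ_w^k g‖`).
The tower, and the (X).3 export `TwoLegSpaceMomentAt`, speak of POSITION MOMENTS of the plain two-leg kernel `S[g](z) = Σ_Q χ̄_Q(z)•g(Q)`.  The dictionary between the two on the
space-TIME product torus (the single-torus `(ℤ/L)^d` twin is Literature's `TorusFourierMomentBound.norm_foldr_fwdDiff_sum_torusChar_smul_le`):

* §1 `charSum_fwdDiff_eq` / `charSum_fwdDiff_iter_eq` — `S[Δ_e^m g](z) = (χ̄_{−e}(z) − 1)^m · S[g](z)`;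
* §2 **`card_mul_norm_fwdDiff_iter_le_sum_moment`** — `(P·L²)·‖Δ_e^m g(Q)‖ ≤ Σ_z ‖χ̄_e(z) − 1‖^m·‖S[g](z)‖` for EVERY direction `e` of the product torus, every order `m`,
  every `Q` (Fourier inversion `sum_pchar_neg_mul_charSum_eq`, p719211);
* §3 the chord bounds for the five directions of the master lemmas: `‖χ̄_{(1,0)}(z) − 1‖ ≤ 2π|z̃₁|/P` (time), `‖χ̄_{(0,eᵢ)}(z) − 1‖ ≤ 2π|z̃₂,ᵢ|/L` (axes),
  `‖χ̄_{(0,v)}(z) − 1‖ ≤ 2π|(v·z⃗₂)~|/L` (any integer frame vector; `v⊥`, `v`);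
* §4 **`card_mul_norm_fwdDiff_iter_time/axis/frame_le_moment`** — the packaged forms `(P·L²)·‖Δ_w^m g(Q)‖ ≤ (2π/P_w)^m · Σ_z |z̃_w|^m·‖S[g](z)‖`: the reader's symbol data
  `b_m(w)` ARE the order-`m` position moments of the plain kernel in the direction `w`, divided by the volume `P·L²` of the dual torus;
* §5 (appended) `norm_sub_le_mul_of_forall_norm_fwdDiff_le` (telescoping) and **`card_mul_norm_sub_steps_le_firstMoments`** — the (ℛ2) OSCILLATION bound:
  the variation of the symbol over `n₀` time steps and `n₁, n₂` axis steps is `≤ (P·L²)⁻¹·Σ_w n_w·(2π/P_w)·M₁(w)` (first directional moments) — a kernel born at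
  scale `Λ′` varies over the input shell of scale `Λ` by `≍ (Λ/Λ′)` of its size: the renormalisation gain of BGM (2.100) in the tree's currencies.

Everything is proved; no definitions, no named facts; nothing here asserts (E2), any engine row, K3 or superconductivity. [folklore]
References: BGM 2006 (2.36aa), (3.3) [cite: BenfattoGiulianiMastropietro2006]; S. Friedli, Y. Velenik, *Statistical Mechanics of Lattice Systems* (2017) §10.4.
-/

noncomputable section

namespace Summit.HubbardSuperconductivity.HubbardSuperconductivity.Theorems.TorusFourierL2

set_option linter.dupNamespace false -- summit = problem name (single-conjunct summit), D-0017

open Finset Complex Literature.Probability.LatticeModels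
open scoped Real ComplexConjugate

variable {P L : ℕ} [NeZero P] [NeZero L]

/-! ### §1 The character sum of a difference -/

/-- **The character sum of a forward difference**: `S[Δ_e g](z) = (χ̄_{−e}(z) − 1)·S[g](z)`. [folklore] -/
theorem charSum_fwdDiff_eq (g : TorusSite 1 P × TorusSite 2 L → ℂ) (e z : TorusSite 1 P × TorusSite 2 L) :
    ∑ Q : TorusSite 1 P × TorusSite 2 L, (torusChar Q.1 z.1 * torusChar Q.2 z.2) • fwdDiff e g Q =
      (torusChar (-e).1 z.1 * torusChar (-e).2 z.2 - 1) * ∑ Q : TorusSite 1 P × TorusSite 2 L, (torusChar Q.1 z.1 * torusChar Q.2 z.2) • g Q := by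
  classical
  simp only [fwdDiff, smul_eq_mul, mul_sub, Finset.sum_sub_distrib, sub_mul, one_mul]
  congr 1
  rw [Finset.mul_sum]
  -- reindex `Q ↦ Q + e`
  rw [← Equiv.sum_comp (Equiv.addRight e) (fun Q => torusChar (-e).1 z.1 * torusChar (-e).2 z.2 * ((torusChar Q.1 z.1 * torusChar Q.2 z.2) * g Q))]
  refine Finset.sum_congr rfl fun Q _ => ?_
  simp only [Equiv.coe_addRight]
  have h : torusChar (Q + e).1 z.1 * torusChar (Q + e).2 z.2 * (torusChar (-e).1 z.1 * torusChar (-e).2 z.2) = torusChar Q.1 z.1 * torusChar Q.2 z.2 := by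
    rw [← pchar_add_left, add_neg_cancel_right]
  calc torusChar Q.1 z.1 * torusChar Q.2 z.2 * g (Q + e)
      = torusChar (Q + e).1 z.1 * torusChar (Q + e).2 z.2 * (torusChar (-e).1 z.1 * torusChar (-e).2 z.2) * g (Q + e) := by rw [h]
    _ = torusChar (-e).1 z.1 * torusChar (-e).2 z.2 * (torusChar (Q + e).1 z.1 * torusChar (Q + e).2 z.2 * g (Q + e)) := by ring

/-- **Iterated**: `S[Δ_e^m g](z) = (χ̄_{−e}(z) − 1)^m·S[g](z)`. [folklore] -/
theorem charSum_fwdDiff_iter_eq (g : TorusSite 1 P × TorusSite 2 L → ℂ) (e z : TorusSite 1 P × TorusSite 2 L) (m : ℕ) :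
    ∑ Q : TorusSite 1 P × TorusSite 2 L, (torusChar Q.1 z.1 * torusChar Q.2 z.2) • (fwdDiff e)^[m] g Q =
      (torusChar (-e).1 z.1 * torusChar (-e).2 z.2 - 1) ^ m * ∑ Q : TorusSite 1 P × TorusSite 2 L, (torusChar Q.1 z.1 * torusChar Q.2 z.2) • g Q := by
  induction m generalizing g with
  | zero => simp
  | succ m ih =>
    rw [Function.iterate_succ_apply, ih (fwdDiff e g), charSum_fwdDiff_eq, pow_succ]
    ring

/-! ### §2 Differences of the symbol from moments of the character sum -/

omit [NeZero P] in
/-- `‖χ̄_{−e}(z) − 1‖ = ‖χ̄_e(z) − 1‖` (complex conjugates). [folklore] -/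
theorem norm_pchar_neg_sub_one (e z : TorusSite 1 P × TorusSite 2 L) [NeZero P] :
    ‖torusChar (-e).1 z.1 * torusChar (-e).2 z.2 - 1‖ = ‖torusChar e.1 z.1 * torusChar e.2 z.2 - 1‖ := by
  rw [Prod.fst_neg, Prod.snd_neg, torusChar_neg_left', torusChar_neg_left', torusChar_neg_right, torusChar_neg_right, ← map_mul,
    ← Complex.norm_conj (torusChar e.1 z.1 * torusChar e.2 z.2 - 1), map_sub, map_one]

/-- **SINGLE-DIRECTION DIFFERENCES OF A SYMBOL ARE BOUNDED BY THE POSITION MOMENTS OF ITS CHARACTER SUM**: for every direction `e` of the product torus,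
every order `m` and every `Q`, `(P·L²)·‖Δ_e^m g(Q)‖ ≤ Σ_z ‖χ̄_e(z) − 1‖^m·‖Σ_{Q′} χ̄_{Q′}(z)•g(Q′)‖`. [cite: BenfattoGiulianiMastropietro2006, (2.36aa) and (3.3)] -/
theorem card_mul_norm_fwdDiff_iter_le_sum_moment (g : TorusSite 1 P × TorusSite 2 L → ℂ) (e : TorusSite 1 P × TorusSite 2 L) (m : ℕ)
    (Q : TorusSite 1 P × TorusSite 2 L) :
    (P : ℝ) * (L : ℝ) ^ 2 * ‖(fwdDiff e)^[m] g Q‖ ≤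
      ∑ z : TorusSite 1 P × TorusSite 2 L, ‖torusChar e.1 z.1 * torusChar e.2 z.2 - 1‖ ^ m *
        ‖∑ Q' : TorusSite 1 P × TorusSite 2 L, (torusChar Q'.1 z.1 * torusChar Q'.2 z.2) • g Q'‖ := by
  have hinv := sum_pchar_neg_mul_charSum_eq ((fwdDiff e)^[m] g) Q
  have hnorm : (P : ℝ) * (L : ℝ) ^ 2 * ‖(fwdDiff e)^[m] g Q‖ = ‖((P : ℂ) * (L : ℂ) ^ 2) * (fwdDiff e)^[m] g Q‖ := by
    rw [norm_mul, norm_mul, norm_pow, Complex.norm_natCast, Complex.norm_natCast]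
  rw [hnorm, ← hinv]
  refine (norm_sum_le _ _).trans (Finset.sum_le_sum fun z _ => ?_)
  rw [charSum_fwdDiff_iter_eq, norm_mul, norm_mul, norm_mul, norm_torusChar, norm_torusChar, one_mul, one_mul, norm_pow,
    norm_pchar_neg_sub_one]

/-! ### §3 The chord bounds in the five directions -/

omit [NeZero L] in
/-- **Time direction**: `‖χ̄_{(1,0)}(z) − 1‖ ≤ 2π|z̃₁|/P`. [folklore] -/
theorem norm_pchar_time_sub_one_le [NeZero L] (z : TorusSite 1 P × TorusSite 2 L) :
    ‖torusChar ((((fun _ : Fin 1 => (1 : ZMod P)), (0 : TorusSite 2 L)) : TorusSite 1 P × TorusSite 2 L)).1 z.1 *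
        torusChar ((((fun _ : Fin 1 => (1 : ZMod P)), (0 : TorusSite 2 L)) : TorusSite 1 P × TorusSite 2 L)).2 z.2 - 1‖ ≤
      2 * π * |(((z.1 0).valMinAbs : ℤ) : ℝ)| / P := by
  have h1 : (fun _ : Fin 1 => (1 : ZMod P)) = Pi.single (0 : Fin 1) (1 : ZMod P) := by
    funext i; fin_cases i; simp
  simp only [torusChar_zero_left, mul_one]
  rw [h1, torusChar_single_left]
  exact norm_stdAddChar_sub_one_le_div (z.1 0)

omit [NeZero P] in
/-- **Axis directions**: `‖χ̄_{(0,eᵢ)}(z) − 1‖ ≤ 2π|z̃₂,ᵢ|/L`. [folklore] -/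
theorem norm_pchar_axis_sub_one_le [NeZero P] (i : Fin 2) (z : TorusSite 1 P × TorusSite 2 L) :
    ‖torusChar ((((0 : TorusSite 1 P), (Pi.single i (1 : ZMod L) : TorusSite 2 L)) : TorusSite 1 P × TorusSite 2 L)).1 z.1 *
        torusChar ((((0 : TorusSite 1 P), (Pi.single i (1 : ZMod L) : TorusSite 2 L)) : TorusSite 1 P × TorusSite 2 L)).2 z.2 - 1‖ ≤
      2 * π * |(((z.2 i).valMinAbs : ℤ) : ℝ)| / L := by
  simp only [torusChar_zero_left, one_mul]
  rw [torusChar_single_left]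
  exact norm_stdAddChar_sub_one_le_div (z.2 i)

omit [NeZero P] in
/-- **Integer frame directions**: for `v : Fin 2 → ℤ`, `‖χ̄_{(0,v)}(z) − 1‖ ≤ 2π|(Σⱼ vⱼ zⱼ)~|/L` (the character of `v` is the character of the lattice functional `z⃗ ↦ v·z⃗`).
[folklore] -/
theorem norm_pchar_frame_sub_one_le [NeZero P] (v : Fin 2 → ℤ) (z : TorusSite 1 P × TorusSite 2 L) :
    ‖torusChar ((((0 : TorusSite 1 P), (fun j => ((v j : ℤ) : ZMod L))) : TorusSite 1 P × TorusSite 2 L)).1 z.1 *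
        torusChar ((((0 : TorusSite 1 P), (fun j => ((v j : ℤ) : ZMod L))) : TorusSite 1 P × TorusSite 2 L)).2 z.2 - 1‖ ≤
      2 * π * |(((∑ j, ((v j : ℤ) : ZMod L) * z.2 j).valMinAbs : ℤ) : ℝ)| / L := by
  simp only [torusChar_zero_left, one_mul]
  have hsum : ∀ (s : Finset (Fin 2)), (ZMod.stdAddChar (∑ j ∈ s, ((v j : ℤ) : ZMod L) * z.2 j) : ℂ) =
      ∏ j ∈ s, (ZMod.stdAddChar (((v j : ℤ) : ZMod L) * z.2 j) : ℂ) := by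
    classical
    intro s
    induction s using Finset.induction_on with
    | empty => simp
    | insert j s hj ih => rw [Finset.sum_insert hj, Finset.prod_insert hj, AddChar.map_add_eq_mul, ih]
  have h : torusChar (fun j => ((v j : ℤ) : ZMod L)) z.2 = (ZMod.stdAddChar (∑ j, ((v j : ℤ) : ZMod L) * z.2 j) : ℂ) := by
    rw [torusChar, hsum]
  rw [h]
  exact norm_stdAddChar_sub_one_le_div _

/-! ### §4 Packaged: symbol differences from directional moments -/

/-- **Time differences from time moments**: `(P·L²)·‖Δ_{(1,0)}^m g(Q)‖ ≤ (2π/P)^m·Σ_z |z̃₁|^m·‖S[g](z)‖`. [cite: BenfattoGiulianiMastropietro2006, (2.36aa) and (3.3)] -/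
theorem card_mul_norm_fwdDiff_iter_time_le_moment (g : TorusSite 1 P × TorusSite 2 L → ℂ) (m : ℕ) (Q : TorusSite 1 P × TorusSite 2 L) :
    (P : ℝ) * (L : ℝ) ^ 2 * ‖(fwdDiff ((((fun _ : Fin 1 => (1 : ZMod P)), (0 : TorusSite 2 L)) : TorusSite 1 P × TorusSite 2 L)))^[m] g Q‖ ≤
      (2 * π / P) ^ m * ∑ z : TorusSite 1 P × TorusSite 2 L, (|(((z.1 0).valMinAbs : ℤ) : ℝ)|) ^ m *
        ‖∑ Q' : TorusSite 1 P × TorusSite 2 L, (torusChar Q'.1 z.1 * torusChar Q'.2 z.2) • g Q'‖ := by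
  refine (card_mul_norm_fwdDiff_iter_le_sum_moment g _ m Q).trans ?_
  rw [Finset.mul_sum]
  refine Finset.sum_le_sum fun z _ => ?_
  rw [← mul_assoc, ← mul_pow]
  refine mul_le_mul_of_nonneg_right (pow_le_pow_left₀ (norm_nonneg _) ((norm_pchar_time_sub_one_le z).trans (le_of_eq ?_)) m) (norm_nonneg _)
  ring

/-- **Axis differences from axis moments**: `(P·L²)·‖Δ_{(0,eᵢ)}^m g(Q)‖ ≤ (2π/L)^m·Σ_z |z̃₂,ᵢ|^m·‖S[g](z)‖`. [cite: BenfattoGiulianiMastropietro2006, (2.36aa) and (3.3)] -/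
theorem card_mul_norm_fwdDiff_iter_axis_le_moment (g : TorusSite 1 P × TorusSite 2 L → ℂ) (i : Fin 2) (m : ℕ) (Q : TorusSite 1 P × TorusSite 2 L) :
    (P : ℝ) * (L : ℝ) ^ 2 * ‖(fwdDiff ((((0 : TorusSite 1 P), (Pi.single i (1 : ZMod L) : TorusSite 2 L)) : TorusSite 1 P × TorusSite 2 L)))^[m] g Q‖ ≤
      (2 * π / L) ^ m * ∑ z : TorusSite 1 P × TorusSite 2 L, (|(((z.2 i).valMinAbs : ℤ) : ℝ)|) ^ m *
        ‖∑ Q' : TorusSite 1 P × TorusSite 2 L, (torusChar Q'.1 z.1 * torusChar Q'.2 z.2) • g Q'‖ := by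
  refine (card_mul_norm_fwdDiff_iter_le_sum_moment g _ m Q).trans ?_
  rw [Finset.mul_sum]
  refine Finset.sum_le_sum fun z _ => ?_
  rw [← mul_assoc, ← mul_pow]
  refine mul_le_mul_of_nonneg_right (pow_le_pow_left₀ (norm_nonneg _) ((norm_pchar_axis_sub_one_le i z).trans (le_of_eq ?_)) m) (norm_nonneg _)
  ring

/-- **Frame differences from frame moments**: for an integer frame vector `v`,
`(P·L²)·‖Δ_{(0,v)}^m g(Q)‖ ≤ (2π/L)^m·Σ_z |(v·z⃗₂)~|^m·‖S[g](z)‖`. [cite: BenfattoGiulianiMastropietro2006, (2.36aa) and (3.3)] -/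
theorem card_mul_norm_fwdDiff_iter_frame_le_moment (g : TorusSite 1 P × TorusSite 2 L → ℂ) (v : Fin 2 → ℤ) (m : ℕ) (Q : TorusSite 1 P × TorusSite 2 L) :
    (P : ℝ) * (L : ℝ) ^ 2 * ‖(fwdDiff ((((0 : TorusSite 1 P), (fun j => ((v j : ℤ) : ZMod L))) : TorusSite 1 P × TorusSite 2 L)))^[m] g Q‖ ≤
      (2 * π / L) ^ m * ∑ z : TorusSite 1 P × TorusSite 2 L, (|(((∑ j, ((v j : ℤ) : ZMod L) * z.2 j).valMinAbs : ℤ) : ℝ)|) ^ m *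
        ‖∑ Q' : TorusSite 1 P × TorusSite 2 L, (torusChar Q'.1 z.1 * torusChar Q'.2 z.2) • g Q'‖ := by
  refine (card_mul_norm_fwdDiff_iter_le_sum_moment g _ m Q).trans ?_
  rw [Finset.mul_sum]
  refine Finset.sum_le_sum fun z _ => ?_
  rw [← mul_assoc, ← mul_pow]
  refine mul_le_mul_of_nonneg_right (pow_le_pow_left₀ (norm_nonneg _) ((norm_pchar_frame_sub_one_le v z).trans (le_of_eq ?_)) m) (norm_nonneg _)
  ring


/-! ### §5 Oscillation along lattice paths: the symbol's variation over a box from first differences (the (ℛ2) telescoping) -/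

/-- **Telescoping along one direction**: `‖g(Q + n•e) − g(Q)‖ ≤ n·sup_Q′ ‖Δ_e g(Q′)‖`. [folklore] -/
theorem norm_sub_le_mul_of_forall_norm_fwdDiff_le {α E : Type*} [AddCommMonoid α] [NormedAddCommGroup E] (g : α → E) (e : α) {D : ℝ}
    (hD : ∀ Q, ‖fwdDiff e g Q‖ ≤ D) (Q : α) (n : ℕ) : ‖g (Q + n • e) - g Q‖ ≤ n * D := by
  induction n with
  | zero => simp
  | succ n ih =>
    have hstep : g (Q + (n + 1) • e) - g Q = fwdDiff e g (Q + n • e) + (g (Q + n • e) - g Q) := by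
      rw [fwdDiff, succ_nsmul, ← add_assoc]; abel
    rw [hstep]
    refine (norm_add_le _ _).trans ?_
    have := hD (Q + n • e)
    push_cast
    linarith

/-- **THE (ℛ2) OSCILLATION BOUND ON THE PRODUCT TORUS**: for lattice step counts `n₀` (time), `n₁, n₂` (axes), the variation of the symbol between `Q` and
`Q + n₀•(1,0) + n₁•(0,e₁) + n₂•(0,e₂)` is at most `(P·L²)⁻¹·[n₀·(2π/P)·M_time + n₁·(2π/L)·M_{axis 1} + n₂·(2π/L)·M_{axis 2}]`, the `M`'s the FIRST directional position
moments of the character sum `S[g]` — the renormalisation gain: a symbol whose kernel is born at scale `Λ′` (moments `≍ Λ′⁻¹·‖S[g]‖₁`) varies over a box of `≍ Λ·L/2π` lattice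
steps by `≍ (Λ/Λ′)·‖S[g]‖₁/(P·L²)`. [cite: BenfattoGiulianiMastropietro2006, §2.6 (2.100), (3.3)] -/
theorem card_mul_norm_sub_steps_le_firstMoments (g : TorusSite 1 P × TorusSite 2 L → ℂ) (Q : TorusSite 1 P × TorusSite 2 L) (n₀ n₁ n₂ : ℕ) :
    (P : ℝ) * (L : ℝ) ^ 2 *
        ‖g (Q + n₀ • ((((fun _ : Fin 1 => (1 : ZMod P)), (0 : TorusSite 2 L)) : TorusSite 1 P × TorusSite 2 L)) +
              n₁ • ((((0 : TorusSite 1 P), (Pi.single 0 (1 : ZMod L) : TorusSite 2 L)) : TorusSite 1 P × TorusSite 2 L)) +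
              n₂ • ((((0 : TorusSite 1 P), (Pi.single 1 (1 : ZMod L) : TorusSite 2 L)) : TorusSite 1 P × TorusSite 2 L))) - g Q‖ ≤
      n₀ * ((2 * π / P) * ∑ z : TorusSite 1 P × TorusSite 2 L, |(((z.1 0).valMinAbs : ℤ) : ℝ)| *
          ‖∑ Q' : TorusSite 1 P × TorusSite 2 L, (torusChar Q'.1 z.1 * torusChar Q'.2 z.2) • g Q'‖) +
        n₁ * ((2 * π / L) * ∑ z : TorusSite 1 P × TorusSite 2 L, |(((z.2 0).valMinAbs : ℤ) : ℝ)| *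
          ‖∑ Q' : TorusSite 1 P × TorusSite 2 L, (torusChar Q'.1 z.1 * torusChar Q'.2 z.2) • g Q'‖) +
        n₂ * ((2 * π / L) * ∑ z : TorusSite 1 P × TorusSite 2 L, |(((z.2 1).valMinAbs : ℤ) : ℝ)| *
          ‖∑ Q' : TorusSite 1 P × TorusSite 2 L, (torusChar Q'.1 z.1 * torusChar Q'.2 z.2) • g Q'‖) := by
  -- the three per-direction sup bounds on `(P·L²)·Δ g`, from the `m = 1` moment lemmas
  set e₀ : TorusSite 1 P × TorusSite 2 L := (((fun _ : Fin 1 => (1 : ZMod P)), (0 : TorusSite 2 L)) : TorusSite 1 P × TorusSite 2 L) with he₀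
  set e₁ : TorusSite 1 P × TorusSite 2 L := (((0 : TorusSite 1 P), (Pi.single 0 (1 : ZMod L) : TorusSite 2 L)) : TorusSite 1 P × TorusSite 2 L) with he₁
  set e₂ : TorusSite 1 P × TorusSite 2 L := (((0 : TorusSite 1 P), (Pi.single 1 (1 : ZMod L) : TorusSite 2 L)) : TorusSite 1 P × TorusSite 2 L) with he₂
  set M₀ : ℝ := (2 * π / P) * ∑ z : TorusSite 1 P × TorusSite 2 L, |(((z.1 0).valMinAbs : ℤ) : ℝ)| *
      ‖∑ Q' : TorusSite 1 P × TorusSite 2 L, (torusChar Q'.1 z.1 * torusChar Q'.2 z.2) • g Q'‖ with hM₀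
  set M₁ : ℝ := (2 * π / L) * ∑ z : TorusSite 1 P × TorusSite 2 L, |(((z.2 0).valMinAbs : ℤ) : ℝ)| *
      ‖∑ Q' : TorusSite 1 P × TorusSite 2 L, (torusChar Q'.1 z.1 * torusChar Q'.2 z.2) • g Q'‖ with hM₁
  set M₂ : ℝ := (2 * π / L) * ∑ z : TorusSite 1 P × TorusSite 2 L, |(((z.2 1).valMinAbs : ℤ) : ℝ)| *
      ‖∑ Q' : TorusSite 1 P × TorusSite 2 L, (torusChar Q'.1 z.1 * torusChar Q'.2 z.2) • g Q'‖ with hM₂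
  -- scaled function `G = (P·L²)·g`
  have hc : ‖((P : ℂ) * (L : ℂ) ^ 2)‖ = (P : ℝ) * (L : ℝ) ^ 2 := by
    rw [norm_mul, norm_pow, Complex.norm_natCast, Complex.norm_natCast]
  set G : TorusSite 1 P × TorusSite 2 L → ℂ := fun Q => ((P : ℂ) * (L : ℂ) ^ 2) * g Q with hG
  have hGdiff : ∀ (e : TorusSite 1 P × TorusSite 2 L) (Q : TorusSite 1 P × TorusSite 2 L),
      ‖fwdDiff e G Q‖ = (P : ℝ) * (L : ℝ) ^ 2 * ‖(fwdDiff e)^[1] g Q‖ := by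
    intro e Q'
    have hf : fwdDiff e G Q' = ((P : ℂ) * (L : ℂ) ^ 2) * (fwdDiff e)^[1] g Q' := by
      simp only [hG, fwdDiff, Function.iterate_one, mul_sub]
    rw [hf, norm_mul, hc]
  have h0 : ∀ Q', ‖fwdDiff e₀ G Q'‖ ≤ M₀ := fun Q' => by
    rw [hGdiff]; simpa only [pow_one] using card_mul_norm_fwdDiff_iter_time_le_moment g 1 Q'
  have h1 : ∀ Q', ‖fwdDiff e₁ G Q'‖ ≤ M₁ := fun Q' => by
    rw [hGdiff]; simpa only [pow_one] using card_mul_norm_fwdDiff_iter_axis_le_moment g 0 1 Q'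
  have h2 : ∀ Q', ‖fwdDiff e₂ G Q'‖ ≤ M₂ := fun Q' => by
    rw [hGdiff]; simpa only [pow_one] using card_mul_norm_fwdDiff_iter_axis_le_moment g 1 1 Q'
  -- telescope in three legs
  have t0 := norm_sub_le_mul_of_forall_norm_fwdDiff_le G e₀ h0 Q n₀
  have t1 := norm_sub_le_mul_of_forall_norm_fwdDiff_le G e₁ h1 (Q + n₀ • e₀) n₁
  have t2 := norm_sub_le_mul_of_forall_norm_fwdDiff_le G e₂ h2 (Q + n₀ • e₀ + n₁ • e₁) n₂
  have htri : ‖G (Q + n₀ • e₀ + n₁ • e₁ + n₂ • e₂) - G Q‖ ≤ n₀ * M₀ + n₁ * M₁ + n₂ * M₂ := by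
    have e : G (Q + n₀ • e₀ + n₁ • e₁ + n₂ • e₂) - G Q =
        (G (Q + n₀ • e₀ + n₁ • e₁ + n₂ • e₂) - G (Q + n₀ • e₀ + n₁ • e₁)) + ((G (Q + n₀ • e₀ + n₁ • e₁) - G (Q + n₀ • e₀)) + (G (Q + n₀ • e₀) - G Q)) := by abel
    rw [e]
    refine (norm_add_le _ _).trans ((add_le_add t2 ((norm_add_le _ _).trans (add_le_add t1 t0))).trans (le_of_eq ?_))
    ring
  have hscale : ‖G (Q + n₀ • e₀ + n₁ • e₁ + n₂ • e₂) - G Q‖ = (P : ℝ) * (L : ℝ) ^ 2 * ‖g (Q + n₀ • e₀ + n₁ • e₁ + n₂ • e₂) - g Q‖ := by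
    have hf : G (Q + n₀ • e₀ + n₁ • e₁ + n₂ • e₂) - G Q = ((P : ℂ) * (L : ℂ) ^ 2) * (g (Q + n₀ • e₀ + n₁ • e₁ + n₂ • e₂) - g Q) := by
      simp only [hG, mul_sub]
    rw [hf, norm_mul, hc]
  rw [← hscale]
  exact htri

end Summit.HubbardSuperconductivity.HubbardSuperconductivity.Theorems.TorusFourierL2

end
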